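import Summits.QuantumFields.YangMills.Theses.ParabolicTrajectory
import Literature.MathematicalPhysics.QuantumFieldTheory.BalabanBanachStep
import Summits.QuantumFields.YangMills.Theorems.ParabolicTrajectoryLatticeGapOnTrajectoryScalingDefs

/-!
# Route `ParabolicTrajectory`, crux `LatticeGapOnTrajectory` (stmt-QuantumFields-10523),
# line `trajectory-gap-scaling`: one-step / phase dynamics for the stub `stub_tubeVisited`

Helper file of `…StubTubeVisited` (the λ-lemma `stub_tubeVisited : TubeVisited`): elementary real
inequalities about the orbit `S.F^[i] (g, S.yW g)` of a Wilson point of a hypothesis structure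
`S : BalabanBanachStep G r M`, using only its recorded fields (`remainder`, `remainder_basin`,
`contraction`, `norm_A_le`, `norm_yW_le`, `betaOf`); nothing is asserted about any instance.

* `tubeVisited_basin_coupling`: on the basin (`0 ≤ g ≤ δ' ≤ δ`, `‖y‖ ≤ R`),
  `|φ g y − g| ≤ (b + C(δ' + R)) g³`.
* `tubeVisited_bichart_coupling`, `tubeVisited_bichart_fibre`: in the `δ'`-bichart with the margins
  `4Cδ' ≤ b`, `2Cδ' ≤ 1 − θ` of `IsCurveData`: `(b/2)g³ ≤ φ g y − g ≤ (3b/2)g³` and `‖Ψ g y‖ ≤ δ'`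
  (packaged as the registered anchor `tubeVisited_bichart_step`).
* `tubeVisited_step1` / `tubeVisited_phase1` (PHASE 1, basin): while the coupling is below a ceiling
  `η` (`cη² ≤ 1/2`, `2Cη² ≤ (1 − θ')δ'`), one step keeps it positive and multiplies it by at most
  `1 + cγ²`, keeps the fibre in the `R`-ball and contracts it: `‖y_l‖ ≤ θ'^l R + δ'/2`.
* `tubeVisited_step2` / `tubeVisited_phase2` (PHASE 2, bichart, coupling `< γ`): monotone drift,
  overshoot `≤ γ'` for a one-domain window `γ + 2bγ³ ≤ γ'`, fibre invariance, linear growth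
  `≥ (b/2) q.1³` per step.
* `tubeVisited_exists_wilson_point`: `betaOf` is onto every large `β` (IVT).
* `tubeVisited_mem_chart`: chart membership from the two coordinate bounds.
-/

open scoped SchwartzMap
open MeasureTheory Filter Topology
open Literature.MathematicalPhysics.QuantumFieldTheory Literature.MathematicalPhysics.QuantumLattice
open Summit.QuantumFields.YangMills.Theses.ParabolicTrajectory

noncomputable section

namespace Summit.QuantumFields.YangMills.Cruxes.LatticeGapOnTrajectory.TrajectoryGapScaling

/-! ## One-step and phase lemmas -/

section Helpers

variable {G : Type} [Group G] [TopologicalSpace G] [IsTopologicalGroup G] [CompactSpace G]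
  [MeasurableSpace G] [BorelSpace G] {r : LatticeRep G} {M : ℕ} (S : BalabanBanachStep G r M)

/-- Membership in the chart `[0, δ] × B̄_R`, from the two coordinate bounds. -/
theorem tubeVisited_mem_chart {p : ℝ × S.E} (h1 : p.1 ∈ Set.Icc 0 S.δ)
    (h2 : ‖p.2‖ ≤ S.R) : p ∈ chart S := by
  simp only [chart, Set.mem_prod, Metric.mem_closedBall, dist_zero_right]
  exact ⟨h1, h2⟩

/-- **Basin step for the coupling** (phase 1): for `0 ≤ g ≤ δ' ≤ δ` and `‖y‖ ≤ R`,
`|φ g y − g| ≤ (b + C(δ' + R)) g³` (from `BalabanBanachStep.abs_φ_sub_le`). -/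
theorem tubeVisited_basin_coupling {δ' g : ℝ} {y : S.E} (hδ'δ : δ' ≤ S.δ) (hg0 : 0 ≤ g)
    (hgδ' : g ≤ δ') (hy : ‖y‖ ≤ S.R) :
    |S.φ g y - g| ≤ (S.b + S.C * (δ' + S.R)) * g ^ 3 := by
  have hgδ : |g| ≤ S.δ := by rw [abs_of_nonneg hg0]; exact hgδ'.trans hδ'δ
  have h := S.abs_φ_sub_le hgδ hy
  rw [abs_of_nonneg hg0] at h
  have hC := S.C_pos.le
  have hg3 : 0 ≤ g ^ 3 := by positivity
  have hg4 : g ^ 4 ≤ δ' * g ^ 3 := by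
    have : g ^ 4 = g * g ^ 3 := by ring
    rw [this]
    exact mul_le_mul_of_nonneg_right hgδ' hg3
  calc |S.φ g y - g| ≤ S.b * g ^ 3 + S.C * (g ^ 4 + g ^ 3 * S.R) := h
    _ ≤ S.b * g ^ 3 + S.C * (δ' * g ^ 3 + g ^ 3 * S.R) := by gcongr
    _ = (S.b + S.C * (δ' + S.R)) * g ^ 3 := by ring

/-- **Bichart drift** (phase 2): for `0 ≤ g ≤ δ' ≤ δ`, `‖y‖ ≤ δ'` and the margin `4Cδ' ≤ b`,
`g + (b/2) g³ ≤ φ g y ≤ g + (3b/2) g³` (from the chart `remainder` bound). -/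
theorem tubeVisited_bichart_coupling {δ' g : ℝ} {y : S.E} (hδ'δ : δ' ≤ S.δ)
    (hmargin : 4 * S.C * δ' ≤ S.b) (hg0 : 0 ≤ g) (hgδ' : g ≤ δ') (hy : ‖y‖ ≤ δ') :
    g + S.b / 2 * g ^ 3 ≤ S.φ g y ∧ S.φ g y ≤ g + 3 * S.b / 2 * g ^ 3 := by
  have hgδ : |g| ≤ S.δ := by rw [abs_of_nonneg hg0]; exact hgδ'.trans hδ'δ
  have hrem := (S.remainder g y hgδ (hy.trans hδ'δ)).1
  rw [abs_of_nonneg hg0] at hrem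
  obtain ⟨h1, h2⟩ := abs_le.1 hrem
  have hC := S.C_pos.le
  have hg3 : 0 ≤ g ^ 3 := by positivity
  have key : S.C * (g ^ 4 + g ^ 3 * ‖y‖) ≤ S.b / 2 * g ^ 3 := by
    calc S.C * (g ^ 4 + g ^ 3 * ‖y‖) ≤ S.C * (g ^ 4 + g ^ 3 * δ') := by gcongr
      _ = S.C * (g + δ') * g ^ 3 := by ring
      _ ≤ S.C * (δ' + δ') * g ^ 3 := by gcongr
      _ = 4 * S.C * δ' / 2 * g ^ 3 := by ring
      _ ≤ S.b / 2 * g ^ 3 := by gcongr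
  constructor <;> linarith

/-- **Bichart fibre invariance** (phase 2): for `0 ≤ g ≤ δ' ≤ δ`, `‖y‖ ≤ δ'` and the margin
`2Cδ' ≤ 1 − θ`, `‖Ψ g y‖ ≤ ‖A‖‖y‖ + C(g² + ‖y‖²) ≤ θδ' + 2Cδ'² ≤ δ'`. -/
theorem tubeVisited_bichart_fibre {δ' g : ℝ} {y : S.E} (hδ'δ : δ' ≤ S.δ)
    (hmargin : 2 * S.C * δ' ≤ 1 - S.θ) (hg0 : 0 ≤ g) (hgδ' : g ≤ δ') (hy : ‖y‖ ≤ δ') :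
    ‖S.Ψ g y‖ ≤ δ' := by
  have hgδ : |g| ≤ S.δ := by rw [abs_of_nonneg hg0]; exact hgδ'.trans hδ'δ
  have hrem := (S.remainder g y hgδ (hy.trans hδ'δ)).2
  have hC := S.C_pos.le
  have hθ := S.θ_nonneg
  have hδ'0 : 0 ≤ δ' := hg0.trans hgδ'
  have hA : ‖S.A y‖ ≤ S.θ * δ' :=
    calc ‖S.A y‖ ≤ ‖S.A‖ * ‖y‖ := S.A.le_opNorm y
      _ ≤ S.θ * δ' := mul_le_mul S.norm_A_le hy (norm_nonneg _) hθ
  have hg2 : g ^ 2 ≤ δ' ^ 2 := pow_le_pow_left₀ hg0 hgδ' 2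
  have hy2 : ‖y‖ ^ 2 ≤ δ' ^ 2 := pow_le_pow_left₀ (norm_nonneg _) hy 2
  calc ‖S.Ψ g y‖ = ‖(S.Ψ g y - S.A y) + S.A y‖ := by rw [sub_add_cancel]
    _ ≤ ‖S.Ψ g y - S.A y‖ + ‖S.A y‖ := norm_add_le _ _
    _ ≤ S.C * (g ^ 2 + ‖y‖ ^ 2) + S.θ * δ' := add_le_add hrem hA
    _ ≤ S.C * (δ' ^ 2 + δ' ^ 2) + S.θ * δ' := by gcongr
    _ = 2 * S.C * δ' * δ' + S.θ * δ' := by ring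
    _ ≤ (1 - S.θ) * δ' + S.θ * δ' := by gcongr
    _ = δ' := by ring

-- adapted from
-- Summits/QuantumFields/YangMills/Cruxes/LatticeGapOnTrajectory/Lines/dissipative-bridge.lean
-- (`exists_wilson_point`)
/-- **`betaOf` is onto every large `β`**: for `0 < g₁ ≤ g₀` there is `β₁` such that every `β ≥ β₁`
is `betaOf g` for some `g ∈ (0, g₁]` (`betaOf → ∞` at `0⁺`, continuity on `(0, g₀]`, IVT). -/
theorem tubeVisited_exists_wilson_point {g₁ : ℝ} (h0 : 0 < g₁) (h1 : g₁ ≤ S.g₀) :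
    ∃ β₁ : ℝ, ∀ β : ℝ, β₁ ≤ β → ∃ g ∈ Set.Ioc 0 g₁, S.betaOf g = β := by
  refine ⟨S.betaOf g₁, fun β hβ => ?_⟩
  have hev : ∀ᶠ g in 𝓝[>] (0 : ℝ), β ≤ S.betaOf g := S.tendsto_betaOf.eventually_ge_atTop β
  have hev' : ∀ᶠ g in 𝓝[>] (0 : ℝ), g ∈ Set.Ioo 0 g₁ := Ioo_mem_nhdsGT h0
  obtain ⟨ε, hε, hεI⟩ := (hev.and hev').exists
  have hcont : ContinuousOn S.betaOf (Set.Icc ε g₁) :=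
    S.continuousOn_betaOf.mono fun x hx => ⟨hεI.1.trans_le hx.1, hx.2.trans h1⟩
  obtain ⟨g, hg, hgβ⟩ := intermediate_value_Icc' hεI.2.le hcont ⟨hβ, hε⟩
  exact ⟨g, ⟨hεI.1.trans_le hg.1, hg.2⟩, hgβ⟩

/-- **Phase-1 step** (basin, coupling frozen below the ceiling `η`): for `0 < g ≤ η` with
`η ≤ δ' ≤ δ`, `η ≤ γ`, `c η² ≤ 1/2`, `2Cη² ≤ (1 − θ')δ'` (`c ≥ b + C(δ' + R)`) and `‖y‖ ≤ R`, the
next coupling is positive and at most `g (1 + cγ²)`, and the next fibre stays in the `R`-ball with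
`‖Ψ g y‖ ≤ θ'‖y‖ + (1 − θ')δ'/2`. -/
theorem tubeVisited_step1 {δ' η c γ : ℝ} (hδ'δ : δ' ≤ S.δ) (hηδ' : η ≤ δ') (hηγ : η ≤ γ)
    (hc : S.b + S.C * (δ' + S.R) ≤ c) (hc0 : 0 ≤ c) (hcη : c * η ^ 2 ≤ 1 / 2)
    (hCη : 2 * S.C * η ^ 2 ≤ (1 - S.θ') * δ') {q : ℝ × S.E} (hq0 : 0 < q.1) (hqη : q.1 ≤ η)
    (hqy : ‖q.2‖ ≤ S.R) :
    0 < (S.F q).1 ∧ (S.F q).1 ≤ q.1 * (1 + c * γ ^ 2) ∧ ‖(S.F q).2‖ ≤ S.R ∧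
      ‖(S.F q).2‖ ≤ S.θ' * ‖q.2‖ + (1 - S.θ') * δ' / 2 := by
  show 0 < S.φ q.1 q.2 ∧ S.φ q.1 q.2 ≤ q.1 * (1 + c * γ ^ 2) ∧ ‖S.Ψ q.1 q.2‖ ≤ S.R ∧
    ‖S.Ψ q.1 q.2‖ ≤ S.θ' * ‖q.2‖ + (1 - S.θ') * δ' / 2
  have hC := S.C_pos
  have hθ1 := S.θ'_lt_one
  have hδ'R : δ' ≤ S.R := hδ'δ.trans S.δ_le_R
  have hqδ' : q.1 ≤ δ' := hqη.trans hηδ'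
  have hqδ : |q.1| ≤ S.δ := by rw [abs_of_pos hq0]; exact hqδ'.trans hδ'δ
  obtain ⟨hlo, hhi⟩ := abs_le.1 (tubeVisited_basin_coupling S hδ'δ hq0.le hqδ' hqy)
  have hq1 : 0 ≤ q.1 := hq0.le
  have hq3 : 0 ≤ q.1 ^ 3 := by positivity
  have hq2 : q.1 ^ 2 ≤ η ^ 2 := pow_le_pow_left₀ hq1 hqη 2
  have hq2γ : q.1 ^ 2 ≤ γ ^ 2 := pow_le_pow_left₀ hq1 (hqη.trans hηγ) 2
  have hdev : (S.b + S.C * (δ' + S.R)) * q.1 ^ 3 ≤ c * q.1 ^ 2 * q.1 :=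
    calc (S.b + S.C * (δ' + S.R)) * q.1 ^ 3 ≤ c * q.1 ^ 3 := mul_le_mul_of_nonneg_right hc hq3
      _ = c * q.1 ^ 2 * q.1 := by ring
  have hlow : (S.b + S.C * (δ' + S.R)) * q.1 ^ 3 ≤ q.1 / 2 :=
    calc (S.b + S.C * (δ' + S.R)) * q.1 ^ 3 ≤ c * q.1 ^ 2 * q.1 := hdev
      _ ≤ c * η ^ 2 * q.1 := by gcongr
      _ ≤ 1 / 2 * q.1 := mul_le_mul_of_nonneg_right hcη hq1
      _ = q.1 / 2 := by ring
  have hup : (S.b + S.C * (δ' + S.R)) * q.1 ^ 3 ≤ c * γ ^ 2 * q.1 :=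
    calc (S.b + S.C * (δ' + S.R)) * q.1 ^ 3 ≤ c * q.1 ^ 2 * q.1 := hdev
      _ ≤ c * γ ^ 2 * q.1 := by gcongr
  have hKq : q.1 * (1 + c * γ ^ 2) = q.1 + c * γ ^ 2 * q.1 := by ring
  have hCq : S.C * q.1 ^ 2 ≤ (1 - S.θ') * δ' / 2 := by
    have := mul_le_mul_of_nonneg_left hq2 hC.le
    linarith
  have hCqR : S.C * q.1 ^ 2 ≤ (1 - S.θ') * S.R := by
    refine hCq.trans ?_
    calc (1 - S.θ') * δ' / 2 = (1 - S.θ') * (δ' / 2) := by ring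
      _ ≤ (1 - S.θ') * S.R := mul_le_mul_of_nonneg_left (by linarith) (by linarith)
  refine ⟨by linarith, by linarith, S.norm_Ψ_le_R hqδ hqy hCqR, ?_⟩
  have := S.norm_Ψ_le hqδ hqy
  linarith

/-- **Phase-2 step** (the `δ'`-bichart below `γ`): for `0 < g < γ ≤ δ' ≤ δ`, `‖y‖ ≤ δ'`, the
margins `4Cδ' ≤ b`, `2Cδ' ≤ 1 − θ`, the window `γ + 2bγ³ ≤ γ'` and `c ≥ 3b/2`: monotone drift
`g + (b/2)g³ ≤ φ g y`, overshoot `φ g y ≤ γ'`, growth `φ g y ≤ g(1 + cγ²)`, fibre `‖Ψ g y‖ ≤ δ'`. -/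
theorem tubeVisited_step2 {δ' γ γ' c : ℝ} (hδ'δ : δ' ≤ S.δ) (hdrift : 4 * S.C * δ' ≤ S.b)
    (hfib : 2 * S.C * δ' ≤ 1 - S.θ) (hγγ' : γ + 2 * S.b * γ ^ 3 ≤ γ') (hγδ' : γ ≤ δ')
    (hc : 3 * S.b / 2 ≤ c) {q : ℝ × S.E} (hq0 : 0 < q.1) (hqγ : q.1 < γ) (hqy : ‖q.2‖ ≤ δ') :
    q.1 + S.b / 2 * q.1 ^ 3 ≤ (S.F q).1 ∧ (S.F q).1 ≤ γ' ∧ (S.F q).1 ≤ q.1 * (1 + c * γ ^ 2) ∧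
      ‖(S.F q).2‖ ≤ δ' := by
  show q.1 + S.b / 2 * q.1 ^ 3 ≤ S.φ q.1 q.2 ∧ S.φ q.1 q.2 ≤ γ' ∧
    S.φ q.1 q.2 ≤ q.1 * (1 + c * γ ^ 2) ∧ ‖S.Ψ q.1 q.2‖ ≤ δ'
  have hb := S.b_pos
  have hq1 : 0 ≤ q.1 := hq0.le
  have hγ0 : 0 ≤ γ := hq1.trans hqγ.le
  have hqδ' : q.1 ≤ δ' := hqγ.le.trans hγδ'
  have hc0 : 0 ≤ c := le_trans (by positivity) hc
  obtain ⟨hlo, hhi⟩ := tubeVisited_bichart_coupling S hδ'δ hdrift hq1 hqδ' hqy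
  refine ⟨hlo, ?_, ?_, tubeVisited_bichart_fibre S hδ'δ hfib hq1 hqδ' hqy⟩
  · have h3 : q.1 ^ 3 ≤ γ ^ 3 := pow_le_pow_left₀ hq1 hqγ.le 3
    have hbq : 3 * S.b / 2 * q.1 ^ 3 ≤ 3 * S.b / 2 * γ ^ 3 :=
      mul_le_mul_of_nonneg_left h3 (by positivity)
    have hγ3 : 0 ≤ S.b * γ ^ 3 := by positivity
    linarith
  · have hq2γ : q.1 ^ 2 ≤ γ ^ 2 := pow_le_pow_left₀ hq1 hqγ.le 2
    have hup : 3 * S.b / 2 * q.1 ^ 3 ≤ c * γ ^ 2 * q.1 :=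
      calc 3 * S.b / 2 * q.1 ^ 3 = 3 * S.b / 2 * q.1 ^ 2 * q.1 := by ring
        _ ≤ c * γ ^ 2 * q.1 := by gcongr
    have hKq : q.1 * (1 + c * γ ^ 2) = q.1 + c * γ ^ 2 * q.1 := by ring
    linarith

/-- **Phase-1 invariant** along the Wilson orbit of `g ∈ (0, g₀]` up to a horizon `L` with
`g (1 + cγ²)^L ≤ η`: the coupling stays in `(0, g (1 + cγ²)^l]`, the fibre stays in the `R`-ball and
is contracted, `‖y_l‖ ≤ θ'^l R + δ'/2`. -/
theorem tubeVisited_phase1 {δ' η c γ : ℝ} (hδ' : 0 < δ') (hδ'δ : δ' ≤ S.δ) (hηδ' : η ≤ δ')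
    (hηγ : η ≤ γ) (hc : S.b + S.C * (δ' + S.R) ≤ c) (hc0 : 0 ≤ c) (hcη : c * η ^ 2 ≤ 1 / 2)
    (hCη : 2 * S.C * η ^ 2 ≤ (1 - S.θ') * δ') {g : ℝ} (hg0 : 0 < g) (hgg₀ : g ≤ S.g₀) {L : ℕ}
    (hgL : g * (1 + c * γ ^ 2) ^ L ≤ η) :
    ∀ l ≤ L, 0 < (S.F^[l] (g, S.yW g)).1 ∧ (S.F^[l] (g, S.yW g)).1 ≤ g * (1 + c * γ ^ 2) ^ l ∧
      ‖(S.F^[l] (g, S.yW g)).2‖ ≤ S.R ∧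
      ‖(S.F^[l] (g, S.yW g)).2‖ ≤ S.θ' ^ l * S.R + δ' / 2 := by
  have hθ0 := S.θ'_nonneg
  set Kg : ℝ := 1 + c * γ ^ 2 with hKg
  have hK1 : 1 ≤ Kg := by
    have : 0 ≤ c * γ ^ 2 := by positivity
    linarith
  have hK0 : 0 ≤ Kg := by linarith
  have hy0 : ‖S.yW g‖ ≤ S.R := S.norm_yW_le g ⟨hg0.le, hgg₀⟩
  intro l
  induction l with
  | zero =>
    intro _
    refine ⟨hg0, by simp, hy0, ?_⟩
    simp only [Function.iterate_zero, id_eq, pow_zero, one_mul]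
    linarith
  | succ l ih =>
    intro hl
    obtain ⟨h0, hgrow, hRl, hfib⟩ := ih (Nat.le_of_succ_le hl)
    have hlη : (S.F^[l] (g, S.yW g)).1 ≤ η := by
      refine hgrow.trans (le_trans ?_ hgL)
      exact mul_le_mul_of_nonneg_left (pow_le_pow_right₀ hK1 (Nat.le_of_succ_le hl)) hg0.le
    obtain ⟨s0, sgrow, sR, sfib⟩ := tubeVisited_step1 S hδ'δ hηδ' hηγ hc hc0 hcη hCη h0 hlη hRl
    rw [Function.iterate_succ_apply']
    refine ⟨s0, ?_, sR, ?_⟩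
    · calc (S.F (S.F^[l] (g, S.yW g))).1 ≤ (S.F^[l] (g, S.yW g)).1 * Kg := sgrow
        _ ≤ g * Kg ^ l * Kg := mul_le_mul_of_nonneg_right hgrow hK0
        _ = g * Kg ^ (l + 1) := by ring
    · calc ‖(S.F (S.F^[l] (g, S.yW g))).2‖
          ≤ S.θ' * ‖(S.F^[l] (g, S.yW g)).2‖ + (1 - S.θ') * δ' / 2 := sfib
        _ ≤ S.θ' * (S.θ' ^ l * S.R + δ' / 2) + (1 - S.θ') * δ' / 2 :=
            add_le_add (mul_le_mul_of_nonneg_left hfib hθ0) le_rfl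
        _ = S.θ' ^ (l + 1) * S.R + δ' / 2 := by ring

/-- **Phase-2 invariant** from a bichart point `q` (`0 < q.1 ≤ γ'`, `‖q.2‖ ≤ δ'`): as long as the
couplings before step `n` are `< γ`, the orbit stays in the `δ'`-bichart with coupling in
`(0, γ']`, at most `q.1 (1 + cγ²)^n` and at least `q.1 + n (b/2) q.1³` (linear growth). -/
theorem tubeVisited_phase2 {δ' γ γ' c : ℝ} (hδ'δ : δ' ≤ S.δ) (hdrift : 4 * S.C * δ' ≤ S.b)
    (hfib : 2 * S.C * δ' ≤ 1 - S.θ) (hγγ' : γ + 2 * S.b * γ ^ 3 ≤ γ') (hγδ' : γ ≤ δ')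
    (hc : 3 * S.b / 2 ≤ c) {q : ℝ × S.E} (hq0 : 0 < q.1) (hqγ' : q.1 ≤ γ') (hqy : ‖q.2‖ ≤ δ') :
    ∀ n : ℕ, (∀ i < n, (S.F^[i] q).1 < γ) →
      0 < (S.F^[n] q).1 ∧ (S.F^[n] q).1 ≤ γ' ∧ ‖(S.F^[n] q).2‖ ≤ δ' ∧
        (S.F^[n] q).1 ≤ q.1 * (1 + c * γ ^ 2) ^ n ∧
        q.1 + n * (S.b / 2 * q.1 ^ 3) ≤ (S.F^[n] q).1 := by
  have hb := S.b_pos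
  have hc0 : 0 ≤ c := le_trans (by positivity) hc
  set Kg : ℝ := 1 + c * γ ^ 2 with hKg
  have hK0 : 0 ≤ Kg := by positivity
  intro n
  induction n with
  | zero =>
    intro _
    refine ⟨hq0, hqγ', hqy, by simp, by simp⟩
  | succ n ih =>
    intro H
    obtain ⟨h0, -, hyδ', hgrow, hlin⟩ := ih fun i hi => H i (Nat.lt_succ_of_lt hi)
    have hγn : (S.F^[n] q).1 < γ := H n (Nat.lt_succ_self n)
    obtain ⟨slo, sγ', sgrow, sfib⟩ := tubeVisited_step2 S hδ'δ hdrift hfib hγγ' hγδ' hc h0 hγn hyδ'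
    rw [Function.iterate_succ_apply']
    have hcur : 0 ≤ (S.F^[n] q).1 := h0.le
    refine ⟨?_, sγ', sfib, ?_, ?_⟩
    · have : 0 ≤ S.b / 2 * (S.F^[n] q).1 ^ 3 := by positivity
      linarith
    · calc (S.F (S.F^[n] q)).1 ≤ (S.F^[n] q).1 * Kg := sgrow
        _ ≤ q.1 * Kg ^ n * Kg := mul_le_mul_of_nonneg_right hgrow hK0
        _ = q.1 * Kg ^ (n + 1) := by ring
    · have hq3 : 0 ≤ S.b / 2 * q.1 ^ 3 := by positivity
      have hge : q.1 ≤ (S.F^[n] q).1 := by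
        have : (0 : ℝ) ≤ n * (S.b / 2 * q.1 ^ 3) := by positivity
        linarith
      have hcube : q.1 ^ 3 ≤ (S.F^[n] q).1 ^ 3 := pow_le_pow_left₀ hq0.le hge 3
      have := mul_le_mul_of_nonneg_left hcube (by positivity : (0 : ℝ) ≤ S.b / 2)
      push_cast
      linarith

end Helpers

/-! ## Registered anchor -/

/-- **Registered anchor of this helper file — the bichart step.** For `0 ≤ g ≤ δ' ≤ δ`, `‖y‖ ≤ δ'`
and the two margins `4Cδ' ≤ b`, `2Cδ' ≤ 1 − θ` of `IsCurveData`: monotone parabolic drift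
`g + (b/2)g³ ≤ φ g y ≤ g + (3b/2)g³` and fibre invariance `‖Ψ g y‖ ≤ δ'`
(`tubeVisited_bichart_coupling` and `tubeVisited_bichart_fibre`). -/
theorem tubeVisited_bichart_step : ∀ {G : Type} [Group G] [TopologicalSpace G] [IsTopologicalGroup G] [CompactSpace G] [MeasurableSpace G] [BorelSpace G] {r : LatticeRep G} {M : ℕ} (S : BalabanBanachStep G r M) {δ' g : ℝ} {y : S.E}, δ' ≤ S.δ → 4 * S.C * δ' ≤ S.b → 2 * S.C * δ' ≤ 1 - S.θ → 0 ≤ g → g ≤ δ' → ‖y‖ ≤ δ' → (g + S.b / 2 * g ^ 3 ≤ S.φ g y ∧ S.φ g y ≤ g + 3 * S.b / 2 * g ^ 3) ∧ ‖S.Ψ g y‖ ≤ δ' := by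
  intro G _ _ _ _ _ _ r M S δ' g y hδ'δ hdrift hfib hg0 hgδ' hy
  exact ⟨tubeVisited_bichart_coupling S hδ'δ hdrift hg0 hgδ' hy,
    tubeVisited_bichart_fibre S hδ'δ hfib hg0 hgδ' hy⟩

end Summit.QuantumFields.YangMills.Cruxes.LatticeGapOnTrajectory.TrajectoryGapScaling

end
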